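import Summits.KontsevichZagierPeriods.KontsevichZagierPeriods.Theorems.IsogenyCertificatesXMapKernelIffSummit
import Summits.KontsevichZagierPeriods.KontsevichZagierPeriods.Theorems.IsogenyCertificatesXMapKernelEtaCell
import Literature.NumberTheory.Transcendental.ManyCurveThetaClassification

/-!
# `XMapKernel` (stmt-KontsevichZagierPeriods-10663, route IsogenyCertificates): the cells of all three lines are
UNCONDITIONAL theorems, and each line's remainder is the summit UNCONDITIONALLY (lead prover a2)

The two sector theorems this crux produced — the REAL-PERIOD CELL of line `isogeny-orbit-collapse`
(`XMapKernelRealPeriodCell.realPeriodCellKernel`, p95323) and the (ω, η)-EGG CELL of line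
`derived-datum-quasi-periods` (`XMapKernelEtaCell.etaCellKernel`, p117210), with the cell of line
`axiom-saturated-sector-peeling` a corollary of the first (`XMapKernelIffSummit.ellipticSectorKernel`, p116992) —
were landed CONDITIONALLY on the named fact `Literature.NumberTheory.Transcendental.HuberWustholzManyCurvePeriods`
(Huber–Wüstholz 2022, Thm. 15.3 (1) for `[ℤ →⁰ 𝔾ₘ] × E₁ × ⋯ × E_k`, pairwise non-isogenous curves, CM allowed),
which every line's skeleton carried as the stub `stub_huberWustholzManyCurvePeriods` ("literature debt").
That fact is now a THEOREM of the tree: `Literature.NumberTheory.Transcendental.HuberWustholzManyCurvePeriods_holds`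
(`Literature/NumberTheory/Transcendental/ManyCurveThetaClassification.lean`: Baker–Wüstholz analytic subgroup
theorem for the `k`-lattice standard models with Philippon's zero estimate for their theta models; axioms
`propext`, `Classical.choice`, `Quot.sound`). This file discharges the hypothesis everywhere:

* `realPeriodIndependence_holds`, `etaIndependence_holds` — the transcendence inputs of the two cells, outright;
* `realPeriodCellKernel_holds` / `realPeriodCellKernel_relations`, `ellipticSectorKernel_holds`,
  `etaCellKernel_holds` — **the cells, outright**: every value-`0` formal `ℤ`-combination of real-period
  representations `[{x³+Ax+B>0}, a/√(x³+Ax+B)]` (`a ∈ ℚ`), resp. of egg representations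
  `[egg(A,B), (a₀+a₁x)/√(x³+Ax+B)]`, is a relation of the KZ calculus;
* `xMapKernel_iff_reductionToRealPeriodSector`, `xMapKernel_iff_offCellReduction_holds`,
  `xMapKernel_of_kernelModElliptic_holds` and `reductionToRealPeriodSector_iff_summit_holds`,
  `offCellReduction_iff_summit_holds`, `kernelModElliptic_iff_summit_holds` — the registered remainder stub of
  EACH of the three lines (`stub_reductionToRealPeriodSector`, `stub_offCellReduction`, `stub_kernelModElliptic`)
  is EQUIVALENT to the summit `KontsevichZagierPeriods` with NO hypothesis left.

Upshot for the crux chain: after this file every registered skeleton of the crux has exactly ONE open stub, its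
remainder K, and K ↔ `KontsevichZagierPeriods` ↔ `XMapKernel` (`XMapKernelIffSummit.xMapKernel_iff_summit`) are
theorems; no literature debt remains anywhere in the three lines. No statement of the tree is changed; theorems only.
-/

noncomputable section

namespace Summit.KontsevichZagierPeriods.IsogenyCertificates.XMapKernelCells

open scoped BigOperators
open Polynomial
open Literature.NumberTheory.Transcendental
open Summit.KontsevichZagierPeriods.KontsevichZagierPeriods.Theses.IsogenyCertificates
open Summit.KontsevichZagierPeriods.XMapKernel.Negative
open Set MeasureTheory

/-! ## The registered stub `stub_huberWustholzManyCurvePeriods` of all three skeletons, discharged -/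

/-- **Stub `stub_huberWustholzManyCurvePeriods` (registered in the skeletons of lines `isogeny-orbit-collapse`,
`derived-datum-quasi-periods`, `axiom-saturated-sector-peeling`), PROVED**: the Huber–Wüstholz `k`-curve period
theorem is the tree's `HuberWustholzManyCurvePeriods_holds` (Baker–Wüstholz analytic subgroup theorem + Philippon's
zero estimate, `ManyCurveThetaClassification.lean`). [cite: HuberWustholz2022, Thm. 15.3 (1)] -/
theorem stub_huberWustholzManyCurvePeriods : Literature.NumberTheory.Transcendental.HuberWustholzManyCurvePeriods :=
  HuberWustholzManyCurvePeriods_holds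

/-! ## The transcendence inputs, discharged -/

/-- **Real-period independence, unconditionally.** The full real periods `Ω(A,B) = ∫_{x³+Ax+B>0} dx/√(x³+Ax+B)`
of finitely many nonsingular integral cubics, pairwise not joined by an x-rational isogeny datum, are `ℚ`-linearly
independent: `XMapKernelRealPeriodCell.realPeriodIndependence` fed with the tree's theorem
`HuberWustholzManyCurvePeriods_holds`. [cite: HuberWustholz2022, Thm. 15.3 (1)] -/
theorem realPeriodIndependence_holds : ∀ (k : ℕ) (A B : Fin k → ℤ) (q : Fin k → ℚ), (∀ i, 4 * A i ^ 3 + 27 * B i ^ 2 ≠ 0) → (∀ i j, i ≠ j → ¬ ∃ (f g : Polynomial ℚ) (c : ℚ), Polynomial.derivative f * g - f * Polynomial.derivative g ≠ 0 ∧ Polynomial.C (c ^ 2) * g * (f ^ 3 + Polynomial.C (A j : ℚ) * f * g ^ 2 + Polynomial.C (B j : ℚ) * g ^ 3) = (Polynomial.X ^ 3 + Polynomial.C (A i : ℚ) * Polynomial.X + Polynomial.C (B i : ℚ)) * (Polynomial.derivative f * g - f * Polynomial.derivative g) ^ 2) → ∑ i, (q i : ℝ) * (∫ x in {x : Fin 1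 → ℝ | 0 < x 0 ^ 3 + (A i : ℝ) * x 0 + (B i : ℝ)}, 1 / Real.sqrt (x 0 ^ 3 + (A i : ℝ) * x 0 + (B i : ℝ))) = 0 → ∀ i, q i = 0 :=
  XMapKernelRealPeriodCell.realPeriodIndependence HuberWustholzManyCurvePeriods_holds

/-- **η-independence, unconditionally.** Real periods and real quasi-periods `Ω_egg, H_egg` of finitely many
three-real-root integral cubics, pairwise not joined by an egg-regular coprime x-rational isogeny datum, are
`ℚ`-linearly independent: `XMapKernelEtaCell.etaIndependence` fed with `HuberWustholzManyCurvePeriods_holds`.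
[cite: HuberWustholz2022, Thm. 15.3 (1)] -/
theorem etaIndependence_holds : ∀ (k : ℕ) (A B : Fin k → ℤ) (p q : Fin k → ℚ), (∀ i, 4 * A i ^ 3 + 27 * B i ^ 2 < 0) → (∀ i j, i ≠ j → ¬ ∃ (f g : ℚ[X]) (c : ℚ), IsCoprime f g ∧ derivative f * g - f * derivative g ≠ 0 ∧ C (c ^ 2) * g * (f ^ 3 + C (A j : ℚ) * f * g ^ 2 + C (B j : ℚ) * g ^ 3) = (X ^ 3 + C (A i : ℚ) * X + C (B i : ℚ)) * (derivative f * g - f * derivative g) ^ 2 ∧ ∀ y ∈ closure ({y : ℝ | 0 < y ^ 3 + (A i : ℝ) * y + (B i : ℝ)} \ connectedComponentIn {y : ℝ | 0 < y ^ 3 + (A i : ℝ) * y + (B i : ℝ)} (1 + |(A i : ℝ)| + |(B i : ℝ)|)), aeval y g ≠ 0) → ∑ i, ((p i : ℝ) * (∫ x in {x : Fin 1 → ℝ | x 0 ∈ {y : ℝ | 0 < y ^ 3 + (A i : ℝ) * y + (B i : ℝ)} \ connectedComponentIn {y : ℝ | 0 < y ^ 3 + (A i : ℝ) * y + (B i :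 ℝ)} (1 + |(A i : ℝ)| + |(B i : ℝ)|)}, 1 / Real.sqrt (x 0 ^ 3 + (A i : ℝ) * x 0 + (B i : ℝ))) + (q i : ℝ) * (∫ x in {x : Fin 1 → ℝ | x 0 ∈ {y : ℝ | 0 < y ^ 3 + (A i : ℝ) * y + (B i : ℝ)} \ connectedComponentIn {y : ℝ | 0 < y ^ 3 + (A i : ℝ) * y + (B i : ℝ)} (1 + |(A i : ℝ)| + |(B i : ℝ)|)}, x 0 / Real.sqrt (x 0 ^ 3 + (A i : ℝ) * x 0 + (B i : ℝ)))) = 0 → ∀ i, p i = 0 ∧ q i = 0 :=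
  XMapKernelEtaCell.etaIndependence HuberWustholzManyCurvePeriods_holds

/-! ## The cells, unconditionally -/

/-- **The real-period cell of `XMapKernel`, unconditionally** (line `isogeny-orbit-collapse`): every value-`0`
element of the subgroup generated by the real-period representations `[{x³+Ax+B>0}, a/√(x³+Ax+B)]`
(`(A,B) ∈ ℤ²` nonsingular, `a ∈ ℚ`) lies in the crux's move group `closure gens`.
[cite: KontsevichZagier2001, §1.2] -/
theorem realPeriodCellKernel_holds : ∀ c ∈ AddSubgroup.closure {d : Literature.NumberTheory.Transcendental.KZ.FormalRep | ∃ (A B : ℤ) (a : ℚ) (r : Literature.NumberTheory.Transcendental.KZ.IntegralRep 1), 4 * A ^ 3 + 27 * B ^ 2 ≠ 0 ∧ r.domain = {x | 0 < x 0 ^ 3 + (A : ℝ) * x 0 + (B : ℝ)} ∧ Set.EqOn r.integrand (fun x => (a : ℝ) / Real.sqrt (x 0 ^ 3 + (A : ℝ) * x 0 + (B : ℝ))) r.domain ∧ d = Literature.NumberTheory.Transcendental.KZ.of r}, Literature.NumberTheory.Transcendental.KZ.eval c = 0 → c ∈ AddSubgroup.closure Summit.KontsevichZagierPeriods.XMapKernel.Negative.gens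 :=
  XMapKernelRealPeriodCell.realPeriodCellKernel HuberWustholzManyCurvePeriods_holds

/-- The same cell into `KZ.relations` (the four-move calculus; `closure gens = KZ.relations` because the x-map
period transfer is proved, `XMapKernelIffSummit.closure_gens_eq_relations_holds`): all `ℤ`-linear relations among
the numbers `a·Ω(A,B)` are generated by the KZ moves. [cite: KontsevichZagier2001, §1.2] -/
theorem realPeriodCellKernel_relations : ∀ c ∈ AddSubgroup.closure {d : Literature.NumberTheory.Transcendental.KZ.FormalRep | ∃ (A B : ℤ) (a : ℚ) (r : Literature.NumberTheory.Transcendental.KZ.IntegralRep 1), 4 * A ^ 3 + 27 * B ^ 2 ≠ 0 ∧ r.domain = {x | 0 < x 0 ^ 3 + (A : ℝ) * x 0 + (B : ℝ)} ∧ Set.EqOn r.integrand (fun x => (a : ℝ) / Real.sqrt (x 0 ^ 3 + (A : ℝ) * x 0 + (B : ℝ))) r.domain ∧ d = Literature.NumberTheory.Transcendental.KZ.of r}, Literature.NumberTheory.Transcendental.KZ.eval c = 0 → c ∈ Literature.NumberTheory.Transcendental.KZ.relations := by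
  intro c hc hc0
  rw [← XMapKernelIffSummit.closure_gens_eq_relations_holds]
  exact realPeriodCellKernel_holds c hc hc0

/-- **The cell of line `axiom-saturated-sector-peeling`, unconditionally** (sector `a ∈ ℚ_{>0}`; corollary of the
real-period cell). [cite: KontsevichZagier2001, §1.2] -/
theorem ellipticSectorKernel_holds : ∀ e ∈ AddSubgroup.closure
    {d : KZ.FormalRep | ∃ (A B : ℤ) (a : ℚ) (r : KZ.IntegralRep 1), 4 * A ^ 3 + 27 * B ^ 2 ≠ 0 ∧ 0 < a ∧
    r.domain = {x | 0 < x 0 ^ 3 + (A : ℝ) * x 0 + (B : ℝ)} ∧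
    Set.EqOn r.integrand (fun x => (a : ℝ) / Real.sqrt (x 0 ^ 3 + (A : ℝ) * x 0 + (B : ℝ))) r.domain ∧
    d = KZ.of r},
    KZ.eval e = 0 → e ∈ AddSubgroup.closure Summit.KontsevichZagierPeriods.XMapKernel.Negative.gens :=
  XMapKernelIffSummit.ellipticSectorKernel HuberWustholzManyCurvePeriods_holds

/-- **The (ω, η)-egg cell of `XMapKernel`, unconditionally** (line `derived-datum-quasi-periods`): every value-`0`
element of the subgroup generated by the egg representations `[egg(A,B), (a₀ + a₁x)/√(x³+Ax+B)]`
(`4A³+27B² < 0`, `a₀, a₁ ∈ ℚ`) is a relation of the four-move KZ calculus. [cite: KontsevichZagier2001, §1.2] -/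
theorem etaCellKernel_holds : ∀ c ∈ AddSubgroup.closure {d : KZ.FormalRep | ∃ (A B : ℤ) (a₀ a₁ : ℚ) (r : KZ.IntegralRep 1), 4 * A ^ 3 + 27 * B ^ 2 < 0 ∧ r.domain = {x | x 0 ∈ {y : ℝ | 0 < y ^ 3 + (A : ℝ) * y + (B : ℝ)} \ connectedComponentIn {y : ℝ | 0 < y ^ 3 + (A : ℝ) * y + (B : ℝ)} (1 + |(A : ℝ)| + |(B : ℝ)|)} ∧ EqOn r.integrand (fun x => ((a₀ : ℝ) + (a₁ : ℝ) * x 0) / Real.sqrt (x 0 ^ 3 + (A : ℝ) * x 0 + (B : ℝ))) r.domain ∧ d = KZ.of r}, KZ.eval c = 0 → c ∈ KZ.relations :=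
  XMapKernelEtaCell.etaCellKernel HuberWustholzManyCurvePeriods_holds

/-! ## Every line's remainder is the crux, and the summit, unconditionally -/

/-- Line `isogeny-orbit-collapse`: the crux is EQUIVALENT to the registered remainder
`stub_reductionToRealPeriodSector`, with no hypothesis. [folklore] -/
theorem xMapKernel_iff_reductionToRealPeriodSector : Summit.KontsevichZagierPeriods.KontsevichZagierPeriods.Theses.IsogenyCertificates.XMapKernel ↔ ∀ c : Literature.NumberTheory.Transcendental.KZ.FormalRep, Literature.NumberTheory.Transcendental.KZ.eval c = 0 → ∃ c' ∈ AddSubgroup.closure {d : Literature.NumberTheory.Transcendental.KZ.FormalRep | ∃ (A B : ℤ) (a : ℚ) (r : Literature.NumberTheory.Transcendental.KZ.IntegralRep 1), 4 * A ^ 3 + 27 * B ^ 2 ≠ 0 ∧ r.domain = {x | 0 < x 0 ^ 3 + (A : ℝ) * x 0 + (B : ℝ)} ∧ Set.EqOn r.integrand (fun x => (a : ℝ) / Real.sqrt (x 0 ^ 3 + (A : ℝ) * x 0 + (B : ℝ))) r.domain ∧ d = Literature.NumberTheory.Transcendental.KZ.of r}, c - c' ∈ AddSubgroup.closure Summit.KontsevichZagierPeriods.XMapKernel.Negative.gens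 :=
  XMapKernelRealPeriodCell.xMapKernel_iff_reduction HuberWustholzManyCurvePeriods_holds

/-- Line `isogeny-orbit-collapse`: the remainder `stub_reductionToRealPeriodSector` IS the summit, with no
hypothesis. [folklore] -/
theorem reductionToRealPeriodSector_iff_summit_holds : (∀ c : KZ.FormalRep, KZ.eval c = 0 → ∃ c' ∈ AddSubgroup.closure
    {d : KZ.FormalRep | ∃ (A B : ℤ) (a : ℚ) (r : KZ.IntegralRep 1), 4 * A ^ 3 + 27 * B ^ 2 ≠ 0 ∧
    r.domain = {x | 0 < x 0 ^ 3 + (A : ℝ) * x 0 + (B : ℝ)} ∧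
    Set.EqOn r.integrand (fun x => (a : ℝ) / Real.sqrt (x 0 ^ 3 + (A : ℝ) * x 0 + (B : ℝ))) r.domain ∧
    d = KZ.of r},
    c - c' ∈ AddSubgroup.closure Summit.KontsevichZagierPeriods.XMapKernel.Negative.gens) ↔
    _root_.KontsevichZagierPeriods :=
  XMapKernelIffSummit.reductionToRealPeriodSector_iff_summit HuberWustholzManyCurvePeriods_holds

/-- Line `derived-datum-quasi-periods`: the crux is EQUIVALENT to the registered remainder `stub_offCellReduction`,
with no hypothesis. [folklore] -/
theorem xMapKernel_iff_offCellReduction_holds : Summit.KontsevichZagierPeriods.KontsevichZagierPeriods.Theses.IsogenyCertificates.XMapKernel ↔ ∀ c : KZ.FormalRep, KZ.eval c = 0 → ∃ c' ∈ AddSubgroup.closure {d : KZ.FormalRep | ∃ (A B : ℤ) (a₀ a₁ : ℚ) (r : KZ.IntegralRep 1), 4 * A ^ 3 + 27 * B ^ 2 < 0 ∧ r.domain = {x | x 0 ∈ {y : ℝ | 0 < y ^ 3 + (A : ℝ) * y + (B : ℝ)} \ connectedComponentIn {y : ℝ | 0 < y ^ 3 + (A : ℝ) * y + (B : ℝ)}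 (1 + |(A : ℝ)| + |(B : ℝ)|)} ∧ EqOn r.integrand (fun x => ((a₀ : ℝ) + (a₁ : ℝ) * x 0) / Real.sqrt (x 0 ^ 3 + (A : ℝ) * x 0 + (B : ℝ))) r.domain ∧ d = KZ.of r}, c - c' ∈ AddSubgroup.closure Summit.KontsevichZagierPeriods.XMapKernel.Negative.gens :=
  XMapKernelEtaCell.xMapKernel_iff_offCellReduction HuberWustholzManyCurvePeriods_holds

/-- Line `derived-datum-quasi-periods`: the remainder `stub_offCellReduction` IS the summit, with no hypothesis.
[folklore] -/
theorem offCellReduction_iff_summit_holds : (∀ c : KZ.FormalRep, KZ.eval c = 0 → ∃ c' ∈ AddSubgroup.closure {d : KZ.FormalRep | ∃ (A B : ℤ) (a₀ a₁ : ℚ) (r : KZ.IntegralRep 1), 4 * A ^ 3 + 27 * B ^ 2 < 0 ∧ r.domain = {x | x 0 ∈ {y : ℝ | 0 < y ^ 3 + (A : ℝ) * y + (B : ℝ)} \ connectedComponentIn {y : ℝ | 0 < y ^ 3 + (A : ℝ) * y + (B : ℝ)} (1 + |(A : ℝ)| + |(B : ℝ)|)} ∧ EqOn r.integrand (fun x =>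 ((a₀ : ℝ) + (a₁ : ℝ) * x 0) / Real.sqrt (x 0 ^ 3 + (A : ℝ) * x 0 + (B : ℝ))) r.domain ∧ d = KZ.of r}, c - c' ∈ AddSubgroup.closure Summit.KontsevichZagierPeriods.XMapKernel.Negative.gens) ↔ KontsevichZagierPeriods :=
  XMapKernelEtaCell.offCellReduction_iff_summit HuberWustholzManyCurvePeriods_holds

/-- Line `axiom-saturated-sector-peeling`: its remainder `KernelModElliptic` implies the crux, with no hypothesis
(the converse `XMapKernelIffSummit.kernelModElliptic_of_xMapKernel` was already unconditional). [folklore] -/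
theorem xMapKernel_of_kernelModElliptic_holds : (∀ c : KZ.FormalRep, KZ.eval c = 0 → ∃ e ∈ AddSubgroup.closure
    {d : KZ.FormalRep | ∃ (A B : ℤ) (a : ℚ) (r : KZ.IntegralRep 1), 4 * A ^ 3 + 27 * B ^ 2 ≠ 0 ∧ 0 < a ∧
    r.domain = {x | 0 < x 0 ^ 3 + (A : ℝ) * x 0 + (B : ℝ)} ∧
    Set.EqOn r.integrand (fun x => (a : ℝ) / Real.sqrt (x 0 ^ 3 + (A : ℝ) * x 0 + (B : ℝ))) r.domain ∧
    d = KZ.of r},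
    c - e ∈ KZ.relations) → XMapKernel :=
  XMapKernelIffSummit.xMapKernel_of_kernelModElliptic HuberWustholzManyCurvePeriods_holds

/-- Line `axiom-saturated-sector-peeling`: the remainder `stub_kernelModElliptic` IS the summit, with no
hypothesis. [folklore] -/
theorem kernelModElliptic_iff_summit_holds : (∀ c : Literature.NumberTheory.Transcendental.KZ.FormalRep, Literature.NumberTheory.Transcendental.KZ.eval c = 0 → ∃ e ∈ AddSubgroup.closure {d : Literature.NumberTheory.Transcendental.KZ.FormalRep | ∃ (A B : ℤ) (a : ℚ) (r : Literature.NumberTheory.Transcendental.KZ.IntegralRep 1), 4 * A ^ 3 + 27 * B ^ 2 ≠ 0 ∧ 0 < a ∧ r.domain = {x | 0 < x 0 ^ 3 + (A : ℝ) * x 0 + (B : ℝ)} ∧ Set.EqOn r.integrand (fun x => (a : ℝ) / Real.sqrt (x 0 ^ 3 + (A : ℝ) * x 0 + (B : ℝ))) r.domain ∧ d = Literature.NumberTheory.Transcendental.KZ.of r}, c - e ∈ Literature.NumberTheory.Transcendental.KZ.relations) ↔ KontsevichZagierPeriods :=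
  XMapKernelIffSummit.kernelModElliptic_iff_summit HuberWustholzManyCurvePeriods_holds

end Summit.KontsevichZagierPeriods.IsogenyCertificates.XMapKernelCells

end
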